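import Summits.ResolutionOfSingularities.ResolutionOfSingularities.Theorems.CylinderCutCells
import Summits.ResolutionOfSingularities.ResolutionOfSingularities.Theorems.MaxContactCutSplitCut
import Summits.ResolutionOfSingularities.ResolutionOfSingularities.Theorems.MaxContactCutTauLadder
import HarnessLib

/-!
# MaxContactCutCylinderCut — the decomp-res node «CylinderCut» BY NAME on the host route `MaxContactCut` (lens-2
g18, pin d60dded1)

Content VERBATIM from the decomp-res lens-2 g18 node `HOME/decomp-res-lens-2/g18/CylinderCut.lean` (pin d60dded1, 2
862 l; HOME = run/shared/lean/pub/decomp-res);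
CRITIC-LEDGER row 150 (+1); landing orders INBOX :446: land the NEW PART ONLY (§C l. 2356–2619 + §U l. 2621–2859) —
the SplitCut restatement §R17 (l. 124–2354, itself
carrying g14–g17 verbatim) is DELETED and the landed modules imported instead (namespaces `…Theorems.PinchCut`,
`…Theorems.JetCut`, `…Theorems.PurityCut`, `…Theorems.SplitCut`
opened; same short names, byte-identical bodies — never two copies).  Namespace `…Theorems.CylinderCut` (the lens's
`Theses.CylinderCut` is gate-reserved), sub-namespace `Cyl`
as in the lens; file split only (tree files ≤ 400 lines): sections, variables, the mid-file `open MvPolynomial` and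
every declaration exactly as in the lens; the node's
global dupNamespace-linter line dropped.  Node files, in import order: `CylinderCutClasses` (§C + the cone-free head
of §U; continued `…2` where the cap cuts) ·
`CylinderCutCells` (§U2–§U4 cone-free: the aside home) · the wiring `MaxContactCutCylinderCut` (§C bridge kernel +
§U BY NAME on the host route, in the Theses cone; imports
`MaxContactCutSplitCut` and the tree's `MaxContactCutTauLadder` ⊃ `MaxContactCutExhaustion`).  All `--supports
stmt-ResolutionOfSingularities-29273` (`MaxContactCut.RungOne`);
nothing closes 29273 — decided halves carry their engines as hypotheses (`JetCylinderExit` is a PORT: paper proof in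
the lens docstring §C.2 / NODE-g18 §2); exactly ONE
located-residual aside on the lens-2 column (`Cyl.CylSpecialRung`, home `CylinderCutCells`) SUPERSEDES g17's
`Split.SplitSpecialRung`, re-located EXACTLY modulo the
cylinder decided half.

THE WIRING of the node VERBATIM, BY NAME on the host route `MaxContactCut` (in the Theses cone), in lens order: the
§C bridge kernel `weakResolution_of_isResolutionOf` (tree kernels
`MaxContactCutExhaustion.weakResolution_of_resolution` / `MaxContactCutTauLadder.weakResolution_iff` BY NAME),
`cylinderExit_of_ports` (ENGINE (Cyl) from the port (JCyl) and the tree aside 30081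
`MaxContactCut.MaxOrderThreefoldResolution` BY NAME), `Cyl.rungOne_iff : MaxContactCut.RungOne ⟺ CylGenericRung ∧
CylSpecialRung`, **`Cyl.closes`**, `cylGenericRung_of_ports`, `closes_of_engines`, and the §U4 EXACT re-locations
(g17's `Split.SplitSpecialRung`, g16's grand, vast, pinch, the tree aside 33866 `MaxContactCut.LeafSpecialRung` ⟺
the cylinder residual modulo the decided half) — 0 sorry.  Imports the aside home `CylinderCutCells`,
`MaxContactCutSplitCut` and `MaxContactCutTauLadder`.  Supports 29273.

This file carries: `weakResolution_of_isResolutionOf`, `isJetCylinderAlong_of_isCylinderAlong`,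
`isUniformJetCylinderCurve_of_isUniformCylinderCurve`, `isJetCylinderCurvePt_of_isCylinderCurvePt`,
`cylinderExit_of_jetCylinderExit`, `cylinderExit_of_ports`, `isCylSpecialPt_iff_of_port`, `Cyl.rungOne_iff`,
`Cyl.cylGenericRung_of_rungOne`, `Cyl.cylSpecialRung_of_rungOne`, `Cyl.cylSpecialRung_iff_rungOne`, `Cyl.closes`,
`Cyl.cylGenericRung_of_ports`, `Cyl.closes_of_engines`, `Cyl.splitSpecialRung_iff_cylSpecialRung`,
`Cyl.grandSpecialRung_iff_cylSpecialRung`, `Cyl.vastSpecialRung_iff_cylSpecialRung`,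
`Cyl.leafSpecialRung_iff_cylSpecialRung`, `Cyl.leafGenericRung_of_cylGenericRung`,
`Cyl.pinchSpecialRung_iff_cylSpecialRung`, `Cyl.closes_of_splitSpecialRung`, `Cyl.split_closes_of_cyl`.

(Sources: Hironaka1964 Ch. III; CossartJannsenSaito2020 Ch. 2, Ch. 8–9; CossartPiltant2008 Prop. 4.2;
CossartPiltant2019 Rem. 3.2; BierstoneGrigorievMilmanWlodarczyk2011 §3.1; Moh1987; Hauser2010Kangaroo; Giraud1975;
Narasimhan1983.)
-/

open CategoryTheory AlgebraicGeometry TopologicalSpace IsLocalRing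
open Literature.AlgebraicGeometry.Resolution
open Summit.ResolutionOfSingularities.ResolutionOfSingularities.Theorems
open Summit.ResolutionOfSingularities.ResolutionOfSingularities.Theorems.WeakOrderReduction
open Summit.ResolutionOfSingularities.ResolutionOfSingularities.Theorems.DeltaFaceCutClasses
open Summit.ResolutionOfSingularities.ResolutionOfSingularities.Theorems.RelativeDeltaCut
open Summit.ResolutionOfSingularities.ResolutionOfSingularities.Theorems.CurveLeafExit
open Summit.ResolutionOfSingularities.ResolutionOfSingularities.Theorems.PinchCut
open Summit.ResolutionOfSingularities.ResolutionOfSingularities.Theorems.JetCut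
open Summit.ResolutionOfSingularities.ResolutionOfSingularities.Theorems.PurityCut
open Summit.ResolutionOfSingularities.ResolutionOfSingularities.Theorems.SplitCut
open Summit.ResolutionOfSingularities.ResolutionOfSingularities.Theses

namespace Summit.ResolutionOfSingularities.ResolutionOfSingularities.Theorems.CylinderCut

section CylinderBridge

/-! ## §C  NEW (g18): LAW (Cyl) — CYLINDERS ALONG THE TOP CURVE (critic window g18 (ii′): PURE-POWER cones `ℓ^{p^s}`
along the curve,
decided by a LAW that transports the SURFACE/THREEFOLD-centre package, with the inhabitant `INSEP = (z + v(u₁+u₂))²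
+ u₁⁵ + u₂⁷ /𝔽₂`).

THE STRUCTURAL DICHOTOMY of this generation (lens «special vs generic»): a principal (or not) germ along a regular
top curve `C` is
EITHER TRANSLATION-SYMMETRIC ALONG `C` — on an open `U ⊇ C` the marked ideal is the pullback `I|_U = π*J` of a max-order datum
`(S, J, n)` on a regular THREEFOLD `S` along a SMOOTH morphism `π : U → S` contracting exactly `C` to the unique top
point `s` of `J`
(class (Cyl), `IsCylinderAlong`; the jet version (JCyl), `IsJetCylinderAlong`, asks the same only modulo `𝔪_s^N 𝒪_U`
for a modulus
`N > n·(len t + 1)` attached to a weak resolution `t` of `(J, n)`) — OR GENUINELY `v`-DEPENDENT (the located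
residual `IsCylSpecialPt`).
The decision of the symmetric side is NOT a chart computation on `I`: it is the TRANSPORT of the threefold package
of `J` (port X1∅ =
`MaxOrderAtomClasses.MaxOrderThreefoldResolutionEmptyAt n`, the boundary-free slice of the tree aside 28616, KNOWN-MOD-PORT:
Cutkosky2009 Thm 5.1 over `k̄`; CossartJannsenSaito2020 / CossartPiltant2019 for the principal case over any field)
along `π`, and for
(JCyl) the JET RIGIDITY LEMMA below.  Every earlier law of the lineage ((M) (C) (J) (T) (L) (L′) (D) (D⁺) (G) (S), the δ-laws of
g11–g13) reads a FACE, a CONE or a LADDER of the transversal expansion and decides by fibre-polynomial algebra; a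
pure `p^s`-th power
`(z + vU)^{p^s}` has NO such readable datum (no middle coefficient, square vertex, sides never clean: LEMMA Q_C
(Q4)) and its first
blow-up turns the top locus into a SURFACE (`Top(I₁, 2) ∩ E = {z₁ = 0}`), which no curve-centre law of the lineage can follow.
The cylinder law follows it with SURFACE CENTRES `π_i⁻¹(Z_i)` — this is the «surface-centre package» the window asks for.

### §C.1  ENGINE (Cyl) `CylinderExit` — DECIDED-MOD-PORT X1∅ (paper proof; kernel reduction
`cylinderExit_of_jetCylinderExit` to (JCyl) + X1∅)
Data: `U ⊇ C = closure {η}` open, `π : U → S` smooth, `S/k` regular separated finite type of dimension `≤ 3`, `J ⊆ 𝒪_S` with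
`ord J ≤ n` everywhere and `ord_x J = n ⟺ x = s`, `s` closed, `I|_U = π*J := J.comap π` (`= J·𝒪_U`), `π⁻¹(s) = C ∩ U = C` pointwise.
(a) X1∅(n) gives `t = (Z₀; Z₁; …; Z_{r−1})`, a resolution of `(S, J, ∅, n)` (BGMW 3.1.3: `Z_i ⊆ Supp(J_i, n)`
regular, final support
empty).  Since `ord J ≤ n − 1` off `s` and a blow-up is an isomorphism off its centre, `Supp(J_i, n) ⊆ σ_i⁻¹(s)` inductively
(tree `IsBlowup.idealOrder_comap_of_not_mem`): ALL centres lie over `s` (`t.CentresOver {s}`), `Z₀ = {s}` or `t = nil`.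
(b) TRANSPORT: pull the tower back along `π`: `U_i := U_{i−1} ×_{S_{i−1}} S_i = Bl_{π_{i−1}⁻¹ Z_{i−1}} U_{i−1}` (blowing up commutes
with FLAT base change: StacksProject Tag 0805; `π` smooth ⇒ flat), `π_i : U_i → S_i` smooth (base change), `U_i`
regular (smooth over
regular: StacksProject Tag 036D / Matsumura 23.7), centres `Z̃_i := π_i⁻¹(Z_i)` regular (smooth over regular) and closed in the `i`-th
blow-up `Y_i` of `Y` (they lie over `C`, which is closed in `Y` and contained in `U`; a centre sequence on the open
`U ⊆ Y` whose
centres are closed in the `Y_i` IS a centre sequence on `Y` — blow-ups are local on the base: bookkeeping (f)).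
(c) ORDERS: `ord_{u} (π_i* J_i) = ord_{π_i u} J_i` for every `u ∈ U_i` (order is invariant under regular =
flat-with-regular-fibres local
homomorphisms: tree `Hironaka2005CompletionOrders.idealOrder_comap_Spec_map_of_isRegularHom`, Hironaka2005 / EGA IV
6.?; smooth ⇒ regular
homomorphism), and the CONTROLLED TRANSFORM commutes with flat pullback: `I_i = π_i* J_i` (the exceptional ideal of
`σ̃_i` is the
pullback of that of `σ_i`; division by its `n`-th power commutes with flat extension).  Hence `Supp(I_i, n) ∩ (over
C) = π_i⁻¹ Supp(J_i, n)`,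
the pulled-back sequence is WEAKLY ADMISSIBLE for `(I, ∅, n)` with all centres over `C`, its top `U_r` is regular,
and at the last stage
NO point over `C` has order `n` (`Supp(J_r, n) = ∅`): `PackageExitsOver I n C` with a VACUOUS `τ`-clause — EXIT BY ORDER.  ∎
Ports NAMED (costume census): X1∅(n) [booked, tree aside 28616/30081 sliced: `maxOrderEmpty_of_bdry`]; (b) Tag 0805,
Tag 036D; (c) order
under regular homomorphisms (tree, Literature `Hironaka2005CompletionOrders`), controlled transform under flat base
change [folklore,
BierstoneGrigorievMilmanWlodarczyk2011 §3; Kollar2007 3.?: «blow-up sequence functors commute with smooth morphisms»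
— the functoriality
package of every modern resolution algorithm, here used only for EXISTENCE].

### §C.2  ENGINE (JCyl) `JetCylinderExit` — DECIDED (paper proof = §C.1 (b)(c) + the JET RIGIDITY LEMMA; no port beyond L)
Data as in (Cyl) except that only `I|_U + 𝒫^N = π*J + 𝒫^N` is asked, `𝒫 := 𝔪_s·𝒪_U = (vanishingIdeal {s}).comap π` (the ideal of the
smooth fibre `π⁻¹(s) = C`), for some `N ≥ n·(r + 1) + 1`, `r = len t`, `t` a WEAK resolution of `(S, J, ∅, n)` GIVEN
IN THE LETTERS
(so no X1∅ is consumed: the class carries its threefold package, exactly as (M)/(L)/(S) carry their exponents).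
JET RIGIDITY LEMMA.  (1) All centres of `t` lie over `s` (as (Cyl) (a): `ord J ≤ n − 1` off `s`, weak admissibility asks
`Z_i ⊆ Supp(J_i, n)`, blow-ups are isomorphisms off their centres), so `Z_0 = {s}` (or `t = nil`, `Top(J, n) = ∅`)
and for `i ≥ 1` the
centre `Z_i` lies in the exceptional locus `σ^{-1}(s)` of `S_i`.  (2) The CONTROLLED JET IDEALS `𝒬_0 := 𝔪_s^N ⊆ 𝒪_S`,
`𝒬_{i−1}·𝒪_{S_i} = I(E_i)ⁿ·𝒬_i` (`E_i` the exceptional divisor of `σ_i : S_i → S_{i−1}`; the `𝒬_i` are invertible)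
are honest ideals with
ORDER `ord_x 𝒬_i ≥ N − i·n` AT EVERY POINT `x` (closed or not) OF THE EXCEPTIONAL LOCUS of `S_i` — induction: for `x
∉ E_i` the blow-up is a
local isomorphism; for `x ∈ E_i`, `x′ = σ_i(x) ∈ Z_{i−1}`, a local generator `q` of `𝒬_{i−1}` at `x′` lies in
`𝔪_{x′}^{N−(i−1)n} ⊆ 𝔪_x^{N−(i−1)n}`,
`q = eⁿ·q_i` with `e` a local equation of the REGULAR divisor `E_i` (`ord_x e = 1`) — the divisibility because
`ord_{Z_{i−1}} 𝒬_{i−1} ≥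
N − (i−1)n ≥ n` (the generic point of `Z_{i−1}` is an exceptional point, or `s` itself for `i = 1`) — and `ord_x` is
ADDITIVE on the regular
local ring `𝒪_{S_i,x}` (its graded ring is a domain), so `ord_x q_i ≥ N − (i−1)n − n`.  Hence for `N ≥ n(r+1) + 1`:
`𝒬_{i,x} ⊆ 𝔪_x^{n+1}`
at every exceptional point of every stage `i ≤ r`, and `ord_{Z_i} 𝒬_i ≥ n` along every centre (no weight or snc
bookkeeping is needed:
strict transforms of old exceptional components may well be singular in a weakly admissible tower — they are never used).
(3) Pull back along the smooth
`π_i` (notation `𝒬̃_i := π_i* 𝒬_i`, `Ĩ_i :=` the controlled transform of `I|_U` under the pulled-back sequence — a priori a fractional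
ideal): the congruence PROPAGATES, `Ĩ_i + 𝒬̃_i = π_i* J_i + 𝒬̃_i` (extend the stage-`(i−1)` congruence to `𝒪_{U_i}`
and divide by the
invertible `I(Ẽ_i)ⁿ`, which divides all three terms: `Ĩ_{i−1}𝒪_{U_i}` by (α), `(π_{i−1}*J_{i−1})𝒪_{U_i} =
I(Ẽ_i)ⁿ·π_i*J_i`, `𝒬̃_{i−1}𝒪_{U_i} = I(Ẽ_i)ⁿ·𝒬̃_i`; base
`i = 0` is the letter), and by induction on `i`: (α) the pulled-back centre `Z̃_i = π_i⁻¹ Z_i` lies in `Supp(Ĩ_i,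
n)` — at `u ∈ Z̃_i`
(over `C`, on the exceptional locus for `i ≥ 1`, on `C = V(𝒫)` for `i = 0` where `𝒬̃_0 = 𝒫^N ⊆ 𝔪_u^N`), `Ĩ_{i,u} ⊆
(π_i*J_i)_u + 𝒬̃_{i,u}
⊆ 𝔪_u^n` because `ord_{π_i u} J_i ≥ n` on `Z_i`; so `Ĩ_{i+1}` is an honest ideal and the sequence is weakly
admissible for `(I, ∅, n)`;
(β) at the last stage, for `u ∈ U_r` over `C`: `(π_r* J_r)_u ⊆ Ĩ_{r,u} + 𝔪_u^{n+1}` and `ord_{π_r u} J_r ≤ n − 1` force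
`ord_u Ĩ_r ≤ n − 1` (else `π_r*J_r ⊆ 𝔪_u^n`, contradicting (c)).  EXIT BY ORDER over all of `C`; centres over `C`;
regular top.  ∎
(If `Top(J, n) = ∅` the letters force `ord I < n` along `C` and the empty package exits.)  The lemma is the TRANSVERSAL FINITE
DETERMINACY of exit packages along a curve: the threefold package of the `v = const` slice decides every germ that
agrees with the
cylinder to order `n·(r + 1) + 1` transversally to `C` — uniformly in `v`, because `𝒫 = 𝔪_s𝒪_U` is the ideal of the whole curve.

### §C.3  KERNEL (0 sorry): `isJetCylinderAlong_of_isCylinderAlong` ((Cyl) ⊆ (JCyl) given X1∅(n): the port's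
resolution IS the jet
datum, `N := n·(len t + 1) + 1`, the congruence from the equality), `cylinderExit_of_jetCylinderExit`, `cylinderExit_of_ports` (with the
TREE aside `MaxContactCut.MaxOrderThreefoldResolution` 30081 BY NAME via `maxOrderEmpty_of_bdry`), the
engine-at-work kernels, and the
inhabitant's ring-level CYLINDER CERTIFICATE over `𝔽₂[z, v, u₁, u₂]`: `represent_INSEP` (the census form `z² +
v²(u₁+u₂)² + u₁⁵ + u₂⁷`
IS `(z + v(u₁+u₂))² + u₁⁵ + u₂⁷`), `insep_eq_aeval_surface` (it IS the pullback of the SURFACE datum `a² + b⁵ + c⁷ ∈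
𝔽₂[a, b, c]` along
`(z + v(u₁+u₂), u₁, u₂)`), `insepFrame_involutive` (`z ↦ z + v(u₁+u₂)` is an `𝔽₂`-algebra AUTOMORPHISM of `𝔽₂[z, v,
u₁, u₂]` — its own
inverse — so `(z + vU, u₁, u₂)` are three of four coordinates and `π` is a coordinate projection `𝔸⁴ → 𝔸³`, smooth). -/

/-- **Bridge kernel** [g18; KERNEL (PROVED) from the TREE kernels `MaxContactCutExhaustion.weakResolution_of_resolution` and
`MaxContactCutTauLadder.weakResolution_iff` BY NAME]: a resolution in the tree's sense (`CentreSeq.IsResolutionOf`,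
BGMW Def. 3.1.3)
is a weak resolution in the sense of `WeakOrderReduction`. (Sources: BierstoneGrigorievMilmanWlodarczyk2011 Def. 3.1.3.) -/
theorem weakResolution_of_isResolutionOf {S : Scheme.{0}} (t : CentreSeq S) (M : MarkedIdeal S)
    (h : t.IsResolutionOf M) : WeakResolution t M :=
  (MaxContactCutTauLadder.weakResolution_iff t M).mpr (MaxContactCutExhaustion.weakResolution_of_resolution t M h)

end CylinderBridge

section CylinderKernels

/-- **(Cyl) ⊆ (JCyl) GIVEN THE PORT** [g18; KERNEL (PROVED)]: under X1∅(n)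
(`MaxOrderAtomClasses.MaxOrderThreefoldResolutionEmptyAt n`,
the boundary-free slice of the tree aside 28616) a cylinder along `closure {η}` is a jet cylinder — the port's resolution `t` of
`(S, J, ∅, n)` is the jet datum (`weakResolution_of_isResolutionOf`), `N := n·(len t + 1) + 1`, and the congruence is the equality.
This is the kernel half of the structural dichotomy: the symmetric side is decided by DESCENT to dimension three. [folklore] -/
theorem isJetCylinderAlong_of_isCylinderAlong {Y : Scheme.{0}} {I : Y.IdealSheafData} {n : ℕ} {η : Y}
    (hX : MaxOrderAtomClasses.MaxOrderThreefoldResolutionEmptyAt n) (h : IsCylinderAlong I n η) :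
    IsJetCylinderAlong I n η := by
  obtain ⟨U, hU, p, hp, k, hk, hkp, S, gS, h1, h2, h3, hS, hdim, π, hπ, J, s, hs, hIJ, hC, hord, htop⟩ := h
  obtain ⟨t, ht⟩ := hX p hp k S gS h1 h2 h3 hS hdim J hord
  exact ⟨U, hU, p, hp, k, hk, hkp, S, gS, h1, h2, h3, hS, hdim, π, hπ, J, s, hs, hC, hord, htop, t,
    n * (t.length + 1) + 1, weakResolution_of_isResolutionOf t _ ht, le_rfl, by rw [hIJ]⟩

/-- Curve level: a uniform cylinder curve is a uniform jet-cylinder curve, given X1∅(n).  KERNEL (PROVED). [folklore] -/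
theorem isUniformJetCylinderCurve_of_isUniformCylinderCurve {Y : Scheme.{0}} {I : Y.IdealSheafData} {n : ℕ} {η : Y}
    (hX : MaxOrderAtomClasses.MaxOrderThreefoldResolutionEmptyAt n) (h : IsUniformCylinderCurve I n η) :
    IsUniformJetCylinderCurve I n η :=
  ⟨h.1, isJetCylinderAlong_of_isCylinderAlong hX h.2⟩

/-- Point level: a cylinder-curve point is a jet-cylinder-curve point, given X1∅(n).  KERNEL (PROVED). [folklore] -/
theorem isJetCylinderCurvePt_of_isCylinderCurvePt {Y : Scheme.{0}} {I : Y.IdealSheafData} {n : ℕ} {y : Y}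
    (hX : MaxOrderAtomClasses.MaxOrderThreefoldResolutionEmptyAt n) (h : IsCylinderCurvePt I n y) :
    IsJetCylinderCurvePt I n y := by
  obtain ⟨η, hηy, hiso, hcurve⟩ := h
  exact ⟨η, hηy, hiso, isUniformJetCylinderCurve_of_isUniformCylinderCurve hX hcurve⟩

/-- **ENGINE (Cyl) from ENGINE (JCyl) and the port X1∅ at every marking `≥ 2`** [g18; KERNEL (PROVED)]. [folklore] -/
theorem cylinderExit_of_jetCylinderExit (hJ : JetCylinderExit)
    (hX : ∀ n : ℕ, 2 ≤ n → MaxOrderAtomClasses.MaxOrderThreefoldResolutionEmptyAt n) : CylinderExit :=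
  fun Y hY I n hn η h => hJ Y hY I n hn η (isUniformJetCylinderCurve_of_isUniformCylinderCurve (hX n hn) h)

/-- **ENGINE (Cyl) from ENGINE (JCyl) and the TREE aside 30081 `MaxContactCut.MaxOrderThreefoldResolution` BY NAME**
(through the tree
kernel `MaxOrderAtomClasses.maxOrderEmpty_of_bdry`).  KERNEL (PROVED). [folklore] -/
theorem cylinderExit_of_ports (hJ : JetCylinderExit) (hX : MaxContactCut.MaxOrderThreefoldResolution) : CylinderExit :=
  cylinderExit_of_jetCylinderExit hJ fun n hn => MaxOrderAtomClasses.maxOrderEmpty_of_bdry n (hX n (by omega))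

end CylinderKernels

/-- Given the port X1∅(n), the residual needs only the jet-cylinder negation (the cylinder class is inside the jet
class).  KERNEL (PROVED). [folklore] -/
theorem isCylSpecialPt_iff_of_port {k : Type} [Field k] {Y : Scheme.{0}} (g : Y ⟶ Spec (.of k)) (hY : Scheme.IsRegular Y)
    (I : Y.IdealSheafData) (n : ℕ) (y : Y) (hX : MaxOrderAtomClasses.MaxOrderThreefoldResolutionEmptyAt n) :
    IsCylSpecialPt g hY I n y ↔ IsSplitSpecialPt g hY I n y ∧ ¬ IsJetCylinderCurvePt I n y :=
  ⟨fun h => ⟨h.1, h.2.2⟩, fun h => ⟨h.1, fun hc => h.2 (isJetCylinderCurvePt_of_isCylinderCurvePt hX hc), h.2⟩⟩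

namespace Cyl

section Kernels

variable {n : ℕ}

/-- **EXACT AT THE RUNG**: `RungOne ⟺ CylGenericRung ∧ CylSpecialRung`. [folklore] -/
theorem rungOne_iff : MaxContactCut.RungOne ↔ CylGenericRung ∧ CylSpecialRung :=
  Leaf.rungOne_iff (L := cylLeaf)

/-- NECESSITY by letter. [folklore] -/
theorem cylGenericRung_of_rungOne (h : MaxContactCut.RungOne) : CylGenericRung := (rungOne_iff.mp h).1

/-- NECESSITY by letter. [folklore] -/
theorem cylSpecialRung_of_rungOne (h : MaxContactCut.RungOne) : CylSpecialRung := (rungOne_iff.mp h).2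

/-- HONESTY KERNEL: modulo the decided half, the located residual IS the rung (cofinal). [folklore] -/
theorem cylSpecialRung_iff_rungOne (hG : CylGenericRung) : CylSpecialRung ↔ MaxContactCut.RungOne :=
  Leaf.specialRung_iff_rungOne (L := cylLeaf) hG

/-- **DECIDING IMPLICATION OF THE NODE**: `MaxContactCut.RungOne` (29273) BY NAME from the two halves. [folklore] -/
theorem closes (hG : CylGenericRung) (hS : CylSpecialRung) : MaxContactCut.RungOne :=
  Leaf.closes (L := cylLeaf) hG hS

/-- **`CylGenericRung` with the cylinder engine DISCHARGED by the ports**: (JCyl) decided on paper, X1 via the TREE aside 30081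
`MaxContactCut.MaxOrderThreefoldResolution` BY NAME. [folklore] -/
theorem cylGenericRung_of_ports (hV : VeryNearCutClasses.VeryNearExit) (hD : DeltaPackageExit)
    (hU : UniformCurvePackageExit) (hR : RelCurvePackageExit) (hN : NormalConeJumpExit)
    (hM : MonomialPinchExit) (hC : FlatConeExit) (hGE : GrandExit) (hSE : SplitConeExit)
    (hJE : JetCylinderExit) (hX : MaxContactCut.MaxOrderThreefoldResolution)
    (hP : ∀ n : ℕ, 2 ≤ n → CurvePackagePort n) (h1 : FaceFormCutClasses.OrderOneContact) : CylGenericRung :=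
  cylGenericRung_of_engines hV hD hU hR hN hM hC hGE hSE (cylinderExit_of_ports hJE hX) hJE hP h1

/-- `RungOne` BY NAME from the engines, the ports and the located residual. [folklore] -/
theorem closes_of_engines (hV : VeryNearCutClasses.VeryNearExit) (hD : DeltaPackageExit)
    (hU : UniformCurvePackageExit) (hR : RelCurvePackageExit) (hN : NormalConeJumpExit)
    (hM : MonomialPinchExit) (hC : FlatConeExit) (hGE : GrandExit) (hSE : SplitConeExit)
    (hJE : JetCylinderExit) (hX : MaxContactCut.MaxOrderThreefoldResolution)
    (hP : ∀ n : ℕ, 2 ≤ n → CurvePackagePort n) (h1 : FaceFormCutClasses.OrderOneContact)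
    (hS : CylSpecialRung) : MaxContactCut.RungOne :=
  closes (cylGenericRung_of_ports hV hD hU hR hN hM hC hGE hSE hJE hX hP h1) hS

/-- **EXACT RE-LOCATION OF g17's `Split.SplitSpecialRung`** (the located residual the instruction names): modulo the
cylinder decided
half, `Split.SplitSpecialRung ⟺ CylSpecialRung`. [folklore] -/
theorem splitSpecialRung_iff_cylSpecialRung (hG : CylGenericRung) : Split.SplitSpecialRung ↔ CylSpecialRung :=
  Split.splitSpecialRung_iff.trans (Leaf.specialRung_iff_of_le splitLeaf_le_cylLeaf hG)

/-- **EXACT RE-LOCATION OF g16's `Grand.GrandSpecialRung`**: modulo the cylinder decided half,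
`Grand.GrandSpecialRung ⟺ CylSpecialRung`.
[folklore] -/
theorem grandSpecialRung_iff_cylSpecialRung (hG : CylGenericRung) : Grand.GrandSpecialRung ↔ CylSpecialRung :=
  Grand.grandSpecialRung_iff.trans (Leaf.specialRung_iff_of_le grandLeaf_le_cylLeaf hG)

/-- **EXACT RE-LOCATION OF g15's `Vast.VastSpecialRung`**: modulo the cylinder decided half, `Vast.VastSpecialRung ⟺
CylSpecialRung`.
[folklore] -/
theorem vastSpecialRung_iff_cylSpecialRung (hG : CylGenericRung) : Vast.VastSpecialRung ↔ CylSpecialRung :=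
  vastSpecialRung_iff.trans (Leaf.specialRung_iff_of_le vastLeaf_le_cylLeaf hG)

/-- **EXACT RE-LOCATION OF THE TREE ASIDE 33866** `MaxContactCut.LeafSpecialRung` BY NAME: modulo the cylinder decided half,
`LeafSpecialRung ⟺ CylSpecialRung`. [folklore] -/
theorem leafSpecialRung_iff_cylSpecialRung (hG : CylGenericRung) : MaxContactCut.LeafSpecialRung ↔ CylSpecialRung :=
  Leaf.leafSpecialRung_iff_specialRung (L := cylLeaf) hG

/-- The tree aside 33865 `MaxContactCut.LeafGenericRung` BY NAME from the cylinder decided half. [folklore] -/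
theorem leafGenericRung_of_cylGenericRung (hG : CylGenericRung) : MaxContactCut.LeafGenericRung :=
  Leaf.leafGenericRung_of_genericRung (L := cylLeaf) hG

/-- **EXACT RE-LOCATION OF g14's `PinchSpecialRung`**: modulo the cylinder decided half, `PinchSpecialRung ⟺ CylSpecialRung`.
[folklore] -/
theorem pinchSpecialRung_iff_cylSpecialRung (hG : CylGenericRung) : PinchSpecialRung ↔ CylSpecialRung :=
  pinchSpecialRung_iff.trans (Leaf.specialRung_iff_of_le pinchLeaf_le_cylLeaf hG)

/-- `RungOne` BY NAME from the cylinder decided half and g17's residual (the old residual still closes). [folklore] -/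
theorem closes_of_splitSpecialRung (hG : CylGenericRung) (hS : Split.SplitSpecialRung) : MaxContactCut.RungOne :=
  closes hG (cylSpecialRung_of_splitSpecialRung hS)

/-- The g17 node's `closes` is RECOVERED from the cylinder halves plus engine-free monotonicity (nothing of g17 is
lost). [folklore] -/
theorem split_closes_of_cyl (hG : CylGenericRung) (hS : CylSpecialRung) : MaxContactCut.RungOne :=
  Split.closes (splitGenericRung_of_cylGenericRung hG) ((splitSpecialRung_iff_cylSpecialRung hG).mpr hS)

end Kernels

end Cyl

end Summit.ResolutionOfSingularities.ResolutionOfSingularities.Theorems.CylinderCut
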